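/-
Copyright (c) 2026. All rights reserved.
Released under Apache 2.0 license as described in the file LICENSE.
Authors: abc-iut cell, wave-3 discharge seat abc-iut-L6-d2 (gen 3) ([AbsTopIII] Prop 5.8 (i)–(iii):
the MODEL of abc-iut-L4-t3's output signature `MonoAnalyticNonarch G` at `G = G_k`, `k ⊆ ℚ̄_p` a
finite extension of `ℚ_p`, built from the real objects of the tree; transport along `G ≅ G_k`).
-/
import Literature.AnabelianGeometry.AbsoluteAnabelian.MonoAnalyticLogShells
import Literature.AnabelianGeometry.AbsoluteAnabelian.GaloisPadicLogShellBridge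
import Literature.AnabelianGeometry.AbsoluteAnabelian.FundamentalExtension
import Literature.NumberTheory.GaloisRepresentations.CohomologicalDimension
import Literature.NumberTheory.GaloisRepresentations.LocalReciprocityProofs
import Literature.AnabelianGeometry.AbsoluteAnabelian.MLFUnitImageReductionProofs
import Literature.IUT.LogThetaLattice.HolomorphicLogShellVolume
import HarnessLib

/-!
# [AbsTopIII] Prop 5.8 (i)–(iii) at the model: `MonoAnalyticNonarch (G_k)` for `k ⊆ ℚ̄_p` finite over `ℚ_p`

S. Mochizuki, *Topics in absolute anabelian geometry III*, J. Math. Sci. Univ. Tokyo 22 (2015)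
[MochizukiAbsTopIII2015], Prop 5.8 (ii), manuscript p. 139 l. 25–33 (lit key
`paper:url-5493eb38cbb7`): "there is a functorial [i.e., relative to `TG⊢`] group-theoretic
algorithm `G ↦ (G ↷ 𝒪^×_k̄(G) ↪ k̄^×(G))` [...] for constructing from `G` the `Γ⃗×_non`-diagram in
`𝒞^{MLF⊢}_{TS⊞}` [...] `𝒪^×_k̄(G) ↪ k̄^×(G)`, `𝒪^×_k̄(G) → k~(G) ↪ (k̄^×)^pf(G)` [...] together
with a topological submodule [...] `ℐ(G) ⊆ k~(G)^G` — which we shall refer to as the log-shell of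
`G`", and Prop 5.8 (iii) p. 140 ("the log-volume `μ^log(G)` [...] normalised by
`μ^log(G)(ℐ(G)) = {-1 - m_G/f_G + e_G·log(p*_G)/log(p_G)}·F(G)`"); printed proof p. 142 l. 10–11:
"The various assertions of Proposition 5.8 are immediate from the definitions and the references
quoted in these definitions."

abc-iut-L4-t3 typed the OUTPUT SIGNATURE of the algorithm as the structure
`MonoAnalyticNonarch (G : ProfiniteGrp)` (`MonoAnalyticLogShells.lean`) and the algorithm itself as
the hypothesis structure `MonoAnalyticNonarchAlgorithm`. THIS FILE gives the kernel MODEL of that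
signature at `G = G_k := Gal(k̄/k)` for `k = E ⊆ ℚ̄_p` a finite extension of `ℚ_p` (the setting
"`k_i ⊆ ℚ̄_p`" of [IUTchIV] Prop 1.1, abc-iut-S1's `PadicSubfields.lean`), EVERY field of which is
the real object of the tree (sub-DAG plan/L4/SUBDAG-AbsTopIII-Prop58ii-Cor52v.md rows P58ii/L05b + A):

* `kbarMul = ℚ̄_p^×` with the Galois action, `kbarUnits = 𝒪^×_{ℚ̄_p}` (abc-iut-L4-t2's
  `unitSubmonoid` / this seat's `unitGroup`), `shell = (ℚ̄_p, +)` — the target of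
  `log_k̄ : k~ = 𝒪^×_k̄/𝒪^μ_k̄ ⥲ k̄` ([AbsTopIII] Def 3.1 (i), `GaloisPadicLog.logEquiv`) —,
  `shellArrow = log_k̄ =` the Iwasawa logarithm `padicLogAlgCl` (`GaloisPadicLog.ofPadicSubfield`),
  `logShell = (p*)⁻¹ ·` pre-log-shell `= ℐ_E ⊆ ℚ̄_p` (Def 5.4 (iii); `GaloisPadicLogShellBridge`);
* `inv = (p, f_E, e_E, m_E)` (abc-iut-S1's `residueDegree`, `absRamificationIdx`, `torsionPExp`);
  `R = ℝ` with `F(G) = f·log p`; `logVol =` abc-iut-L4-t3's Haar log-volume `localLogVolume E` of the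
  trace on `E` — the printed NORMALISATION is then exactly this seat's (gen 0)
  `Literature.IUT.LogThetaLattice.holMonoVolumeCompatible_ofUnitLog` ([IUTchIII] Prop 1.2 (vi));
* `integralImage`, `multImage =` the images of `𝒪_E^▷`, `E^×` under a local reciprocity map
  `θ : E^× → G_E^ab` (the tree's `IsLocalReciprocityMap`, PROVED to exist:
  `exists_isLocalReciprocityMap_holds`), for which `E ⊆ ℚ̄_p` is first shown to be a
  non-archimedean local field in Mathlib's sense (`PadicAlgCl.isNonarchimedeanLocalField_subfield`).

Also: the TRANSPORT `MonoAnalyticNonarch.comap` along `G ≃ₜ* H` (abelianizations via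
`profiniteAbelianizationCongr`), used by the sibling file `MonoAnalyticNonarchAlgorithmModel.lean` to
inhabit `MonoAnalyticNonarchAlgorithm` by `out G :=` transport of this model along a chosen `G ≅ G_E`.
HONEST FRAMING: classical (`p`-adic analysis, Haar measure, local class field theory as proved in the
tree); nothing here bears on [IUTchIII] Cor. 3.12; typed ≠ discharged.
-/

set_option autoImplicit false

noncomputable section

namespace Literature.AnabelianGeometry.AbsoluteAnabelian

open Set ValuativeRel Field
open scoped ValuativeRel Pointwise NNReal
open Literature.NumberTheory.GaloisRepresentations Literature.NumberTheory.Transcendental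
open Literature.IUT.LogVolume (residueDegree absRamificationIdx torsionPExp residueDegree_pos
  absRamificationIdx_pos logUnits)
open scoped Literature.IUT.LogVolume

universe u

/-! ## The real line `ℝ` with a distinguished nonzero element, as an `RLine` -/

namespace RLine

/-- `ℝ` itself with the distinguished element `c ≠ 0` (e.g. `c = f·log p`, "the element
corresponding to `f_G·log(p_G)`"), as an `RLine`. [cite: MochizukiAbsTopIII2015, Prop 5.8 (iii) p. 140] -/
def real (c : ℝ) (hc : c ≠ 0) : RLine.{0} where
  carrier := ℝ
  frob := c
  frob_ne_zero := hc
  exists_eq_smul x := ⟨x / c, by rw [smul_eq_mul, div_mul_cancel₀ x hc]⟩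

/-- On `RLine.real c`, the coordinate of `x` is `x / c`. [cite: MochizukiAbsTopIII2015, Def 5.9 (i) p. 143] -/
theorem real_coord (c : ℝ) (hc : c ≠ 0) (x : ℝ) : (real c hc).coord x = x / c := by
  have h := (real c hc).coord_smul_frob x
  change (real c hc).coord x * c = x at h
  rw [eq_div_iff hc, h]

/-- On `RLine.real c`, `toReal c x = x`. [cite: MochizukiAbsTopIII2015, Prop 5.8 (iii) p. 140] -/
@[simp] theorem real_toReal (c : ℝ) (hc : c ≠ 0) (x : ℝ) : (real c hc).toReal c x = x := by
  unfold toReal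
  rw [real_coord, div_mul_cancel₀ x hc]

end RLine

/-! ## Transport of the output signature along an isomorphism of profinite groups -/

section Transport

variable {G H : ProfiniteGrp.{u}}

/-- The isomorphism of profinite abelianizations `G^ab ⥲ H^ab` induced by `e : G ⥲ H` (functoriality
of `G ↦ G^ab` in Prop 5.8 (i); `e` maps `closure [G, G]` onto `closure [H, H]` by abc-iut-L4-d1's
`map_topologicalClosure_commutator_eq`). [cite: MochizukiAbsTopIII2015, Prop 5.8 (i) p. 139] -/
def profiniteAbelianizationCongr (e : G ≃ₜ* H) :
    profiniteAbelianization G ≃* profiniteAbelianization H :=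
  QuotientGroup.congr _ _ e.toMulEquiv (map_topologicalClosure_commutator_eq e)

/-- `(G^ab ⥲ H^ab) [g] = [e g]`. [cite: MochizukiAbsTopIII2015, Prop 5.8 (i) p. 139] -/
@[simp] theorem profiniteAbelianizationCongr_mk (e : G ≃ₜ* H) (g : G) :
    profiniteAbelianizationCongr e (QuotientGroup.mk g) = QuotientGroup.mk (e g) := rfl

namespace MonoAnalyticNonarch

/-- **Transport of structure** ("functorial [i.e., relative to `TG⊢`]", here for isomorphisms): the
output data at `H` pulled back along an isomorphism of profinite groups `e : G ⥲ H` — same carriers,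
`G` acting through `e`, the images in `G^ab` pulled back along `G^ab ⥲ H^ab`.
[cite: MochizukiAbsTopIII2015, Prop 5.8 (ii) p. 139] -/
def comap (e : G ≃ₜ* H) (A : MonoAnalyticNonarch H) : MonoAnalyticNonarch G where
  inv := A.inv
  integralImage := A.integralImage.comap (profiniteAbelianizationCongr e).toMonoidHom
  multImage := A.multImage.comap (profiniteAbelianizationCongr e).toMonoidHom
  integralImage_le _ hx := A.integralImage_le hx
  kbarMul := A.kbarMul
  actKbar := MulAction.compHom A.kbarMul e.toMulEquiv.toMonoidHom
  kbarUnits := A.kbarUnits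
  smul_mem_kbarUnits g _ hx := A.smul_mem_kbarUnits (e g) hx
  shell := A.shell
  actShell := DistribMulAction.compHom A.shell e.toMulEquiv.toMonoidHom
  shellArrow := A.shellArrow
  shellArrow_smul g x := A.shellArrow_smul (e g) x
  logShell := A.logShell
  smul_eq_of_mem_logShell g _ hx := A.smul_eq_of_mem_logShell (e g) hx
  R := A.R
  logVol := A.logVol
  logVol_logShell := A.logVol_logShell

/-- Transport does not change `p, f, e, m`. [cite: MochizukiAbsTopIII2015, Prop 5.8 (i) p. 139] -/
@[simp] theorem comap_inv (e : G ≃ₜ* H) (A : MonoAnalyticNonarch H) : (A.comap e).inv = A.inv := rfl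

/-- Transport does not change the log-shell. [cite: MochizukiAbsTopIII2015, Prop 5.8 (ii) p. 139] -/
theorem comap_logShell (e : G ≃ₜ* H) (A : MonoAnalyticNonarch H) :
    (A.comap e).logShell = A.logShell := rfl

/-- Transport does not change the real log-volume. [cite: MochizukiAbsTopIII2015, Prop 5.8 (iii) p. 140] -/
theorem comap_realLogVol (e : G ≃ₜ* H) (A : MonoAnalyticNonarch H) (S : Set A.shell) :
    (A.comap e).realLogVol S = A.realLogVol S := rfl

end MonoAnalyticNonarch

end Transport

/-! ## Finite `E ⊆ ℚ̄_p`: the Galois group, the local field structure, the reciprocity map -/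

section Subfield

variable {p : ℕ} [hp : Fact p.Prime] (E : IntermediateField ℚ_[p] (PadicAlgCl p))

/-- `G_E = Gal(Ē/E) ⥲ Gal(ℚ̄_p/E)`: the absolute Galois group of `E` (on Mathlib's `AlgebraicClosure E`)
identified with the automorphism group of the algebraic closure `ℚ̄_p ⊇ E` (conjugation by
`IsAlgClosure.equiv`; the tree's `algEquivContinuousMulEquivAbsoluteGaloisGroup`).
[cite: MochizukiAbsTopIII2015, Def 3.1 (i) p. 66] -/
def PadicAlgCl.subfieldGalEquiv : absoluteGaloisGroup E ≃ₜ* (PadicAlgCl p ≃ₐ[E] PadicAlgCl p) :=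
  haveI := PadicAlgCl.isAlgClosure_subfield E
  (algEquivContinuousMulEquivAbsoluteGaloisGroup E (PadicAlgCl p)).symm

/-- `G_E` acting on `ℚ̄_p^×` (through `subfieldGalEquiv`), as a homomorphism to `Aut(ℚ̄_p^×)`.
[cite: MochizukiAbsTopIII2015, Def 3.1 (i) p. 66] -/
def PadicAlgCl.subfieldGalUnitsHom : absoluteGaloisGroup E →* MulAut (PadicAlgCl p)ˣ where
  toFun g := Units.mapEquiv ((PadicAlgCl.subfieldGalEquiv E g : PadicAlgCl p ≃ₐ[E] PadicAlgCl p) :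
    PadicAlgCl p ≃* PadicAlgCl p)
  map_one' := by
    ext u
    simp only [map_one]
    rfl
  map_mul' g h := by
    ext u
    simp only [map_mul]
    rfl

variable [FiniteDimensional ℚ_[p] E]

/-- **A finite `E ⊆ ℚ̄_p` is a non-archimedean local field** in Mathlib's sense, for the valuative
relation of the restricted absolute value (`PadicAlgCl.subfieldValuativeRel`) and the subspace
topology: the topology is that of the (restricted, ultrametric) norm, hence valuative; `E` is locally
compact (finite-dimensional over `ℚ_p`); the valuation is non-trivial.
[cite: MochizukiAbsTopIII2015, Def 3.1 (i) p. 66] -/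
theorem PadicAlgCl.isNonarchimedeanLocalField_subfield :
    @IsNonarchimedeanLocalField E _ (PadicAlgCl.subfieldValuativeRel E) _ := by
  letI := PadicAlgCl.subfieldValuativeRel E
  haveI hc : (NormedField.valuation (K := E)).Compatible :=
    ⟨fun x y => Iff.rfl⟩
  haveI : IsValuativeTopology E := by
    letI : Valued E ℝ≥0 := NormedField.toValued
    exact IsValuativeTopology.of_mem_nhds_zero_iff_vle (v := NormedField.valuation (K := E))
      Valued.mem_nhds_zero
  haveI : ValuativeRel.IsNontrivial E := by
    rw [ValuativeRel.isNontrivial_iff_isNontrivial (NormedField.valuation (K := E))]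
    obtain ⟨x, hx⟩ := NormedField.exists_one_lt_norm E
    refine ⟨x, ?_, ?_⟩
    · have h : (0 : ℝ) < ‖x‖ := one_pos.trans hx
      simpa [NormedField.valuation_apply, ← NNReal.coe_pos] using h
    · have h : (1 : ℝ) ≠ ‖x‖ := hx.ne
      intro h1
      apply h
      have := congrArg (fun t : ℝ≥0 => (t : ℝ)) h1
      simpa [NormedField.valuation_apply] using this.symm
  exact {}

/-- **A local reciprocity map of `E`** (Serre's `x ↦ (x, */E)`: injective, image = image of the Weil
group, units onto the image of inertia, uniformisers to Frobenius classes — the tree's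
`IsLocalReciprocityMap`, whose existence is the tree's theorem `exists_isLocalReciprocityMap_holds`),
chosen once for `E`. [cite: MochizukiAbsTopIII2015, Prop 5.8 (i) p. 139] -/
def PadicAlgCl.subfieldRecMap :
    Eˣ →* absoluteGaloisGroupAbelianization E :=
  letI := PadicAlgCl.subfieldValuativeRel E
  haveI := PadicAlgCl.isNonarchimedeanLocalField_subfield E
  Classical.choose (exists_isLocalReciprocityMap_holds E)

/-- The chosen map IS a local reciprocity map. [cite: MochizukiAbsTopIII2015, Prop 5.8 (i) p. 139] -/
theorem PadicAlgCl.isLocalReciprocityMap_subfieldRecMap :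
    letI := PadicAlgCl.subfieldValuativeRel E
    haveI := PadicAlgCl.isNonarchimedeanLocalField_subfield E
    IsLocalReciprocityMap E (PadicAlgCl.subfieldRecMap E) :=
  letI := PadicAlgCl.subfieldValuativeRel E
  haveI := PadicAlgCl.isNonarchimedeanLocalField_subfield E
  Classical.choose_spec (exists_isLocalReciprocityMap_holds E)

/-- `𝒪_E^▷ = 𝒪_E ∖ {0}`, the non-zero integers, as a submonoid of `E^×` (`‖x‖ ≤ 1`).
[cite: MochizukiAbsTopIII2015, Prop 5.8 (i) p. 139] -/
def PadicAlgCl.subfieldIntegralUnits : Submonoid Eˣ where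
  carrier := {x | ‖(x : E)‖ ≤ 1}
  one_mem' := by simp
  mul_mem' {x y} hx hy := by
    change ‖((x * y : Eˣ) : E)‖ ≤ 1
    rw [Units.val_mul, norm_mul]
    exact mul_le_one₀ hx (norm_nonneg _) hy

/-- The numerical type `(p, f, e, m)` OF `E` (abc-iut-S1's residue degree, absolute ramification index
and `p`-power torsion exponent). [cite: MochizukiAbsTopIII2015, Prop 5.8 (i) p. 139] -/
def MLFType.ofPadicSubfield : MLFType where
  p := p
  prime_p := hp.out
  f := residueDegree p E
  f_pos := residueDegree_pos p E
  e := absRamificationIdx p E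
  e_pos := absRamificationIdx_pos p E
  m := torsionPExp p E

/-! ## The model -/

variable [MeasurableSpace E] [BorelSpace E]

/-- **[AbsTopIII] Prop 5.8 (i)–(iii) at the model `G = G_E`, `E ⊆ ℚ̄_p` finite over `ℚ_p`.** Every field
of abc-iut-L4-t3's output signature filled with the genuine object: (i) `inv = (p, f_E, e_E, m_E)`,
`integralImage`/`multImage` = the images of `𝒪_E^▷ ↪ G_E^ab`, `E^× ↪ G_E^ab` under the reciprocity
map; (ii) `k̄^×(G) = ℚ̄_p^×`, `𝒪^×_k̄(G) = 𝒪^×_{ℚ̄_p}`, `k~(G) = (ℚ̄_p, +)` via `log_k̄`, the shell-arrow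
`= log_k̄ = padicLogAlgCl` (kernel `𝒪^μ`, onto: `GaloisPadicLog.logEquiv`), `ℐ(G) = (p*)⁻¹·log_k̄(𝒪_E^×)
= ℐ_E`; (iii) `R_non(G) = ℝ ∋ F(G) = f·log p`, `μ^log(G) =` the Haar log-volume of abc-iut-L4-t3 on
the trace in `E`, with the PRINTED normalisation `μ^log(G)(ℐ(G)) = {-1 - m/f + e·log(p*)/log p}·F(G)`
holding by `holMonoVolumeCompatible_ofUnitLog` (DAG node AbsTopIII:Prop5.8(ii), sub-DAG rows P58ii/L05b + A; feeds
IUTchIII:Prop1.2(vi)). [cite: MochizukiAbsTopIII2015, Prop 5.8 (ii) p. 139] -/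
def MonoAnalyticNonarch.ofPadicSubfield : MonoAnalyticNonarch (absoluteGaloisGrp E) :=
  letI := PadicAlgCl.subfieldValuativeRel E
  { inv := MLFType.ofPadicSubfield E
    integralImage := (PadicAlgCl.subfieldIntegralUnits E).map (PadicAlgCl.subfieldRecMap E)
    multImage := (PadicAlgCl.subfieldRecMap E).range
    integralImage_le := by
      rintro _ ⟨x, -, rfl⟩
      exact ⟨x, rfl⟩
    kbarMul := (PadicAlgCl p)ˣ
    actKbar := MulAction.compHom (PadicAlgCl p)ˣ (PadicAlgCl.subfieldGalUnitsHom E)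
    kbarUnits := unitGroup E (PadicAlgCl p)
    smul_mem_kbarUnits := fun g x hx => by
      change Units.map _ x ∈ unitGroup E (PadicAlgCl p)
      rw [mem_unitGroup_iff, Units.coe_map]
      exact smul_mem_unitSubmonoid (PadicAlgCl.subfieldGalEquiv E g) hx
    shell := PadicAlgCl p
    actShell := DistribMulAction.compHom (PadicAlgCl p)
      (PadicAlgCl.subfieldGalEquiv E).toMulEquiv.toMonoidHom
    shellArrow := fun u => padicLogAlgCl p ((u : (PadicAlgCl p)ˣ) : PadicAlgCl p)
    shellArrow_smul := fun g u => by
      change padicLogAlgCl p ((PadicAlgCl.subfieldGalEquiv E g) ((u : (PadicAlgCl p)ˣ) : PadicAlgCl p)) =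
        (PadicAlgCl.subfieldGalEquiv E g) (padicLogAlgCl p ((u : (PadicAlgCl p)ˣ) : PadicAlgCl p))
      have h := (GaloisPadicLog.ofPadicSubfield E).log_smul (PadicAlgCl.subfieldGalEquiv E g) _ u.2
      simpa [AlgEquiv.smul_def] using h
    logShell := ((p ^ (if p = 2 then 2 else 1) : ℕ) : PadicAlgCl p)⁻¹ •
      ((GaloisPadicLog.ofPadicSubfield E).preLogShell : Set (PadicAlgCl p))
    smul_eq_of_mem_logShell := fun g x hx => by
      obtain ⟨y, hy, rfl⟩ := Set.mem_smul_set.mp hx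
      have hfix := (GaloisPadicLog.ofPadicSubfield E).smul_eq_self_of_mem_preLogShell hy
        (PadicAlgCl.subfieldGalEquiv E g)
      rw [AlgEquiv.smul_def] at hfix
      change (PadicAlgCl.subfieldGalEquiv E g) (_ • y) = _
      rw [smul_eq_mul, map_mul, map_inv₀, map_natCast, hfix]
    R := RLine.real (MLFType.ofPadicSubfield E).frobeniusWeight
      (MLFType.ofPadicSubfield E).frobeniusWeight_pos.ne'
    logVol := fun S => localLogVolume E ((fun x : E => (x : PadicAlgCl p)) ⁻¹' S)
    logVol_logShell := by
      change localLogVolume E _ = (MLFType.ofPadicSubfield E).logShellCoeff *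
        (MLFType.ofPadicSubfield E).frobeniusWeight
      have hpre : (fun x : E => (x : PadicAlgCl p)) ⁻¹'
          (((p ^ (if p = 2 then 2 else 1) : ℕ) : PadicAlgCl p)⁻¹ •
            ((GaloisPadicLog.ofPadicSubfield E).preLogShell : Set (PadicAlgCl p))) =
          AbsoluteAnabelian.logShell (PadicLogOnUnits.ofUnitLog p E) := by
        rw [pstar_inv_smul_preLogShell_ofPadicSubfield]
        exact Set.preimage_image_eq _ Subtype.val_injective
      rw [hpre]
      exact Literature.IUT.LogThetaLattice.holMonoVolumeCompatible_ofUnitLog p E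
        (MLFType.ofPadicSubfield E) rfl rfl rfl rfl }

/-! ## The fields of the model ARE the real objects -/

namespace MonoAnalyticNonarch

/-- (i) the reconstructed invariants are `(p, f_E, e_E, m_E)`. [cite: MochizukiAbsTopIII2015, Prop 5.8 (i) p. 139] -/
theorem ofPadicSubfield_inv : (ofPadicSubfield E).inv = MLFType.ofPadicSubfield E := rfl

/-- (i) `Im(k^×) =` the image of the reciprocity map `=` the image of the Weil group in `G_E^ab`.
[cite: MochizukiAbsTopIII2015, Prop 5.8 (i) p. 139] -/
theorem ofPadicSubfield_multImage :
    letI := PadicAlgCl.subfieldValuativeRel E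
    haveI := PadicAlgCl.isNonarchimedeanLocalField_subfield E
    (ofPadicSubfield E).multImage = (weilSubgroup E).map (absGaloisAbProj E) := by
  letI := PadicAlgCl.subfieldValuativeRel E
  haveI := PadicAlgCl.isNonarchimedeanLocalField_subfield E
  exact (PadicAlgCl.isLocalReciprocityMap_subfieldRecMap E).range_eq

/-- (i) `Im(𝒪_k^▷) =` the image of `𝒪_E^▷` under the reciprocity map. [cite: MochizukiAbsTopIII2015, Prop 5.8 (i) p. 139] -/
theorem ofPadicSubfield_integralImage :
    (ofPadicSubfield E).integralImage =
      (PadicAlgCl.subfieldIntegralUnits E).map (PadicAlgCl.subfieldRecMap E) := rfl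

/-- (ii) `𝒪^×_k̄(G) = 𝒪^×_{ℚ̄_p}` (abc-iut-L4-t2's `unitSubmonoid`, as the subgroup `unitGroup` of `ℚ̄_p^×`).
[cite: MochizukiAbsTopIII2015, Prop 5.8 (ii) p. 139] -/
theorem ofPadicSubfield_kbarUnits :
    letI := PadicAlgCl.subfieldValuativeRel E
    (ofPadicSubfield E).kbarUnits = unitGroup E (PadicAlgCl p) := rfl

/-- (ii) the shell-arrow `𝒪^×_k̄(G) → k~(G)` is `log_k̄ = padicLogAlgCl`. [cite: MochizukiAbsTopIII2015, Prop 5.8 (ii) p. 139] -/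
theorem ofPadicSubfield_shellArrow (u : (ofPadicSubfield E).kbarUnits) :
    (ofPadicSubfield E).shellArrow u = padicLogAlgCl p (Units.val u.1 : PadicAlgCl p) := rfl

/-- (ii) `k~(G) = (𝒪^×_k̄)^pf(G)`: the shell-arrow kills exactly the roots of unity …
[cite: MochizukiAbsTopIII2015, Prop 5.8 (ii) p. 139] -/
theorem ofPadicSubfield_shellArrow_eq_zero_iff (u : (ofPadicSubfield E).kbarUnits) :
    (ofPadicSubfield E).shellArrow u = 0 ↔
      ∃ n : ℕ, 0 < n ∧ (Units.val u.1 : PadicAlgCl p) ^ n = 1 := by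
  letI := PadicAlgCl.subfieldValuativeRel E
  exact (GaloisPadicLog.ofPadicSubfield E).log_eq_zero_iff _ u.2

/-- … and maps ONTO `k~(G) = (ℚ̄_p, +)`. [cite: MochizukiAbsTopIII2015, Prop 5.8 (ii) p. 139] -/
theorem ofPadicSubfield_shellArrow_surjective : Function.Surjective (ofPadicSubfield E).shellArrow := by
  letI := PadicAlgCl.subfieldValuativeRel E
  intro y
  obtain ⟨x, hx, hxy⟩ := (GaloisPadicLog.ofPadicSubfield E).log_surjective y
  obtain ⟨u, rfl⟩ := exists_unitGroup_val_eq hx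
  exact ⟨u, hxy⟩

/-- (ii) **`ℐ(G) = ℐ_E`**: the log-shell of the model is the log-shell `(p*)⁻¹·log_p(𝒪_E^×)` of
[AbsTopIII] Def 5.4 (iii) / [IUTchIII] Def 1.1 (i) at the standard model of the real logarithm
(abc-iut-L4-t3's `logShell (PadicLogOnUnits.ofUnitLog p E)`), embedded in `ℚ̄_p`.
[cite: MochizukiAbsTopIII2015, Prop 5.8 (ii) p. 139] -/
theorem ofPadicSubfield_logShell :
    (ofPadicSubfield E).logShell =
      ((fun x : E => (x : PadicAlgCl p)) '' AbsoluteAnabelian.logShell (PadicLogOnUnits.ofUnitLog p E) :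
        Set (PadicAlgCl p)) :=
  pstar_inv_smul_preLogShell_ofPadicSubfield E

/-- (iii) `μ^log(G)` read in `ℝ` IS the Haar log-volume of the trace on `E`. [cite: MochizukiAbsTopIII2015, Prop 5.8 (iii) p. 140] -/
theorem ofPadicSubfield_realLogVol (S : Set (PadicAlgCl p)) :
    (ofPadicSubfield E).realLogVol S = localLogVolume E ((fun x : E => (x : PadicAlgCl p)) ⁻¹' S) :=
  RLine.real_toReal _ _ _

/-- (iii) in real terms: `μ^log(ℐ_E) = e·f·log p* − (f + m)·log p`. [cite: MochizukiAbsTopIII2015, Prop 5.8 (iii) p. 140] -/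
theorem ofPadicSubfield_realLogVol_logShell :
    (ofPadicSubfield E).realLogVol (ofPadicSubfield E).logShell =
      (MLFType.ofPadicSubfield E).logShellLogVolume :=
  (ofPadicSubfield E).realLogVol_logShell

end MonoAnalyticNonarch

end Subfield

end Literature.AnabelianGeometry.AbsoluteAnabelian

end
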